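import Summits.QuantumFields.BalabanUV.Beta.BubbleParity
import Literature.MathematicalPhysics.QuantumFieldTheory.Balaban1983to89.Beta.BalabanStepW2

/-!
# `BalabanUV.Beta.D1BFx.TadpoleParity` — road «BF-x» for binder row D1, leaf K-R4 (criticality / chain-rule CHECK), part 1:
# the ONE-POINT FUNCTION `tadpole K S = tr (K ∘ S)` of a plain-antisymmetric BLOCK-DIAGONAL table against a sgn-symmetric
# propagator VANISHES; applied to the typed step resolvents `KInvStep Lc j` this kills the one-point functions of the Wilson cubic
# stencil `wilsonA`, of an1's constraint Hessian `hessFF` and hence of the multiplier table `M1`; what parity does NOT kill is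
# recorded exactly: the one-point function of the unfolded stencil `Spure` reduces to that of its field–multiplier («vh») border piece

HONEST FRAMING (cell contract, verbatim): «discharging `BetaPertH` makes Bałaban's UV stability UNCONDITIONAL — a real constructive-QFT
result; it is NOT the continuum limit and NOT the Clay problem.»  This module is [folklore] kernel algebra over the cell's typed objects
(`TameKernelCalculus`, `BorderedHessianSymmetry`, `BubbleParity`, `StepJetData`, `AveragingHessianKernels`, `BalabanStepW2` BY NAME).  It
cites nothing, mints no `Prop`, instantiates no binder of the β-function wall and discharges nothing of it.  NOT summit progress; NOT
BetaPertH, NOT continuum, NOT Clay.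
HONEST DEPENDENCY: continuum YM on T⁴ ⇐ BetaPertH ∧ nine spine estimates (0/9 proved); BetaPertH ⇐ (D1) ∧ (D4) ∧ CAP+tail; G-an2-4 gates
asym, D1 and NE2/3/4.

WHY (skeleton `HOME/beta/skeletons/D1-b2b-balaban-beta-d1-p2.md` node R, leaf R4 «CRITICALITY / CHAIN RULE»; the owner's QUESTION X-d1p2-2,
journal l.5435).  The second-order carrier `SecondOrderResponse.W2OfK K N S M S₂ M₂` of the typed family has a FOURTH summand
`dM (K2OfK K N S M ν y′) N S M μ y` = (second minimiser/multiplier response) × (first-order tables); it enters the one-loop kernel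
`hessKer` only through the TADPOLE, where — by the Fubini decomposition of part 2 (`D1BFx/Criticality`) — it is a superposition of the
ONE-POINT FUNCTIONS `tadpole K (S κ u)` and `tadpole K (M ρ w)` of the first-order tables.  In Bałaban's model every such one-point
function carries the colour trace `tr_C (ad t_e) = 0` (`ColourTrace.trace_adMat_gen`; B12 (4.35)'s mechanism); the colourless STRIPPING
CONVENTION (`StepJetData` §5: stencils PLAIN-antisymmetric, the packed resolvent sgn-SYMMETRIC — `BubbleParity.trK_KInvStep`) can reproduce
that zero only where a PARITY does.  THIS FILE records exactly where it does:
* §1 `tadpole_eq_neg_tadpole_trK` (antisymmetric localised `S`: `tadpole K S = −tadpole Kᵀ S`), `tadpole_eq_zero_of_symm` (`Kᵀ = K`),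
  **`tadpole_eq_zero_of_parity`** (`Kᵀ = sgnK K` and `S` BLOCK-DIAGONAL, `sgnK S = S` ⟹ `tadpole K S = 0`) — the companion of
  `BubbleParity.bubble_eq_zero_of_parity`; for an OFF-diagonal antisymmetric table (`sgnK S = −S`) the same computation is a tautology:
  parity is silent (`tadpole_offDiag_tautology` is NOT stated — nothing to prove).
* §2 the typed tables: `trK_wilsonA` / `sgnK_wilsonA` / `loc_wilsonA`, `trK_hessFF` / `sgnK_hessFF` / `loc_hessFF`, hence
  **`tadpole_wilsonA_eq_zero`**, **`tadpole_hessFF_eq_zero`**, **`tadpole_M1_eq_zero`** for every sgn-symmetric spread `K`, and at the step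
  resolvents `tadpole_KInvStep_wilsonA_eq_zero` / `tadpole_KInvStep_hessFF_eq_zero` / `tadpole_KInvStep_M1_eq_zero` (every `j`).
* §3 what survives: **`tadpole_Spure_zero`** — `tadpole K (Spure d Lc cE cVH cΛ 0 κ u) = cVH · tadpole K (mfNeg (vhS d Lc κ u))` (the Wilson
  piece drops by §2; the one-step border piece `mfNeg vhS` is OFF-diagonal, parity does not touch it), and `tadpole_Spure_succ` — member
  `j+1` reduces to `(cE·wE)·tadpole K (e3Of …) + (cVH·wVH)·tadpole K (mfNeg vhS …)` (the stripped antisymmetry of the value-function jet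
  `e3Of` is NOT in the tree — `BalabanStepJetsSucc`, «WHAT IS NOT HERE (d)» — so no parity statement is made for it).
READING (context only; asserted nowhere): the K-R4 check therefore reduces, at member `0` of the wall's `WbalOf`, to ONE explicit finite
question — does the vh one-point function `tadpole (KInvStep Lc 0) (mfNeg (vhS d Lc κ u))` vanish? — which part 2 isolates as the exact
coefficient of the surviving second-response term.  Nothing about its value is asserted here.
-/

open Finset
open scoped BigOperators
open Literature.MathematicalPhysics.QuantumFieldTheory
open Literature.MathematicalPhysics.QuantumFieldTheory.Balaban1983to89
open Literature.MathematicalPhysics.QuantumFieldTheory.Balaban1983to89.Beta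
open ExpKernelCalculus (MKer Decays BiLoc comp tr tadpole)
open OneStepResolventKernel (Fib LocStencil)
open OneStepKernelFamily (KInvStep)
open StepJetData (wilsonA mfNeg locStencil_wilsonA wilsonA_antisymm locStencil_mfNeg)
open AveragingHessianKernels (hessFF vhS hessFF_antisymm hessFF_inl_inr hessFF_inr biLoc_hessFF locStencil_vhS)
open BalabanStepJetsSucc (e3Of wE wVH locStencil_e3Of)
open BalabanStepW2 (Spure M1 wM1 Spure_zero Spure_succ)
open KernelReflection (tadpole_smul)
open Summit.QuantumFields.BalabanUV.Beta.TameKernelCalculus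
open Summit.QuantumFields.BalabanUV.Beta.BorderedHessian (sgnK sgnK_apply sgnK_eq_self)
open Summit.QuantumFields.BalabanUV.Beta.BubbleParity (trK_eq_neg_of_antisymm tr_neg tr_sgnK comp_sgnK_left_of_eq_self trK_KInvStep
  spr_KInvStep)

namespace Summit.QuantumFields.BalabanUV.Beta.D1BFx.TadpoleParity

noncomputable section

/-! ## §1 Parity for the tadpole (the one-point function) -/

section Generic

variable {D : ℕ} {F : Type*} [Fintype F]

/-- [folklore] **ANTISYMMETRIC VERTEX: `tadpole K S = −tadpole Kᵀ S`.**  For a spread propagator `K` and a localised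
plain-antisymmetric table `S` (`Sᵀ = −S`): `tr (K∘S) = tr ((K∘S)ᵀ) = tr (Sᵀ∘Kᵀ) = −tr (S∘Kᵀ) = −tr (Kᵀ∘S)` (tame cyclicity). -/
theorem tadpole_eq_neg_tadpole_trK {K S : MKer D F} (hK : Spr K) (hS : Loc S) (hSt : trK S = -S) :
    tadpole K S = -tadpole (trK K) S := by
  unfold ExpKernelCalculus.tadpole
  have h1 : tr (comp K S) = tr (trK (comp K S)) := (tr_trK _).symm
  rw [h1, trK_comp, hSt, comp_neg_left, tr_neg, tr_comp_comm_loc hS hK.trK.tame]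

/-- [folklore] **SYMMETRIC PROPAGATOR, ANTISYMMETRIC VERTEX ⟹ NO ONE-POINT FUNCTION**: `Kᵀ = K`, `Sᵀ = −S` ⟹ `tadpole K S = 0`. -/
theorem tadpole_eq_zero_of_symm {K S : MKer D F} (hK : Spr K) (hKt : trK K = K) (hS : Loc S) (hSt : trK S = -S) :
    tadpole K S = 0 := by
  have h := tadpole_eq_neg_tadpole_trK hK hS hSt
  rw [hKt] at h
  linarith

end Generic

variable {d : ℕ}

/-- [folklore] **PARITY LEMMA FOR THE TADPOLE.**  A sgn-symmetric spread propagator (`Kᵀ = sgnK K`: field–field and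
multiplier–multiplier blocks symmetric, field–multiplier blocks antisymmetric — the cell's packed resolvents) has NO one-point function
against a localised plain-antisymmetric BLOCK-DIAGONAL table (`Sᵀ = −S`, `sgnK S = S`): `tadpole K S = 0`.
(`tadpole K S = −tadpole (sgnK K) S = −tr (sgnK (K∘S)) = −tadpole K S`.)  The companion of `BubbleParity.bubble_eq_zero_of_parity`. -/
theorem tadpole_eq_zero_of_parity {K S : MKer (d + 1) (Fib d)} (hK : Spr K) (hKt : trK K = sgnK K) (hS : Loc S)
    (hSt : trK S = -S) (hSs : sgnK S = S) : tadpole K S = 0 := by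
  have h := tadpole_eq_neg_tadpole_trK hK hS hSt
  rw [hKt] at h
  have h2 : tadpole (sgnK K) S = tadpole K S := by
    unfold ExpKernelCalculus.tadpole
    rw [comp_sgnK_left_of_eq_self hSs, tr_sgnK]
  rw [h2] at h
  linarith

/-! ## §2 The typed block-diagonal tables: the Wilson cubic stencil and the constraint Hessian -/

/-- [folklore] The Wilson cubic stencil is plain-antisymmetric (`StepJetData.wilsonA_antisymm`). -/
theorem trK_wilsonA (κ : Fin (d + 1)) (u : Fin (d + 1) → ℤ) : trK (wilsonA d κ u) = -wilsonA d κ u :=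
  trK_eq_neg_of_antisymm fun x z a b => wilsonA_antisymm κ u x z a b

/-- [folklore] The Wilson cubic stencil is block-diagonal (its field–multiplier blocks are `0` by definition). -/
theorem sgnK_wilsonA (κ : Fin (d + 1)) (u : Fin (d + 1) → ℤ) : sgnK (wilsonA d κ u) = wilsonA d κ u :=
  sgnK_eq_self (fun _ _ _ _ => rfl) (fun _ _ _ _ => rfl)

/-- [folklore] The Wilson cubic stencil is localised (at its bond, rate `1`). -/
theorem loc_wilsonA (κ : Fin (d + 1)) (u : Fin (d + 1) → ℤ) : Loc (wilsonA d κ u) :=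
  ⟨u, u, _, 1, one_pos, locStencil_wilsonA (d := d) zero_le_one κ u⟩

/-- [folklore] **NO WILSON ONE-POINT FUNCTION** against any sgn-symmetric spread propagator. -/
theorem tadpole_wilsonA_eq_zero {K : MKer (d + 1) (Fib d)} (hK : Spr K) (hKt : trK K = sgnK K) (κ : Fin (d + 1))
    (u : Fin (d + 1) → ℤ) : tadpole K (wilsonA d κ u) = 0 :=
  tadpole_eq_zero_of_parity hK hKt (loc_wilsonA κ u) (trK_wilsonA κ u) (sgnK_wilsonA κ u)

/-- [folklore] an1's constraint Hessian is plain-antisymmetric (`AveragingHessianKernels.hessFF_antisymm`). -/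
theorem trK_hessFF (L : ℕ) (ρ : Fin (d + 1)) (w : Fin (d + 1) → ℤ) : trK (hessFF (d := d) L ρ w) = -hessFF L ρ w :=
  trK_eq_neg_of_antisymm fun x z a b => hessFF_antisymm L ρ w x z a b

/-- [folklore] an1's constraint Hessian is block-diagonal (supported on the field–field block). -/
theorem sgnK_hessFF (L : ℕ) (ρ : Fin (d + 1)) (w : Fin (d + 1) → ℤ) : sgnK (hessFF (d := d) L ρ w) = hessFF L ρ w :=
  sgnK_eq_self (fun x y κ l => hessFF_inl_inr L ρ w x y κ l) (fun x y κ l => hessFF_inr L ρ w x y κ (Sum.inl l))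

/-- [folklore] an1's constraint Hessian is localised (at the coarse bond's fine image). -/
theorem loc_hessFF {L : ℕ} (hL : 1 ≤ L) (ρ : Fin (d + 1)) (w : Fin (d + 1) → ℤ) : Loc (hessFF (d := d) L ρ w) :=
  ⟨(L : ℤ) • w, (L : ℤ) • w, _, 1, one_pos, biLoc_hessFF hL ρ w zero_le_one⟩

/-- [folklore] **NO CONSTRAINT-HESSIAN ONE-POINT FUNCTION** against any sgn-symmetric spread propagator. -/
theorem tadpole_hessFF_eq_zero {K : MKer (d + 1) (Fib d)} (hK : Spr K) (hKt : trK K = sgnK K) {L : ℕ} (hL : 1 ≤ L)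
    (ρ : Fin (d + 1)) (w : Fin (d + 1) → ℤ) : tadpole K (hessFF (d := d) L ρ w) = 0 :=
  tadpole_eq_zero_of_parity hK hKt (loc_hessFF hL ρ w) (trK_hessFF L ρ w) (sgnK_hessFF L ρ w)

/-- [folklore] **NO MULTIPLIER ONE-POINT FUNCTION**: the first multiplier table `M1 j ρ w = (cΛ·wM1 j) • hessFF Lc ρ w` of the step-`j`
operator (`BalabanStepW2.M1`) has vanishing one-point function against any sgn-symmetric spread propagator. -/
theorem tadpole_M1_eq_zero {K : MKer (d + 1) (Fib d)} (hK : Spr K) (hKt : trK K = sgnK K) {Lc : ℕ} (hLc : 1 ≤ Lc) (cΛ : ℝ)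
    (j : ℕ) (ρ : Fin (d + 1)) (w : Fin (d + 1) → ℤ) : tadpole K (M1 d Lc cΛ j ρ w) = 0 := by
  show tadpole K ((cΛ * wM1 d Lc j) • hessFF Lc ρ w) = 0
  rw [tadpole_smul, tadpole_hessFF_eq_zero hK hKt hLc ρ w, mul_zero]

/-- [folklore] At the step resolvents (sgn-symmetric: `BubbleParity.trK_KInvStep`; spread: `spr_KInvStep`): no Wilson one-point function,
for every step `j` and every bond. -/
theorem tadpole_KInvStep_wilsonA_eq_zero (Lc : ℕ) [NeZero Lc] (j : ℕ) (κ : Fin (d + 1)) (u : Fin (d + 1) → ℤ) :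
    tadpole (KInvStep (d := d) Lc j) (wilsonA d κ u) = 0 :=
  tadpole_wilsonA_eq_zero (spr_KInvStep Lc j) (trK_KInvStep Lc j) κ u

/-- [folklore] At the step resolvents: no constraint-Hessian one-point function, for every `j` and every coarse bond. -/
theorem tadpole_KInvStep_hessFF_eq_zero (Lc : ℕ) [NeZero Lc] (j : ℕ) {L : ℕ} (hL : 1 ≤ L) (ρ : Fin (d + 1))
    (w : Fin (d + 1) → ℤ) : tadpole (KInvStep (d := d) Lc j) (hessFF (d := d) L ρ w) = 0 :=
  tadpole_hessFF_eq_zero (spr_KInvStep Lc j) (trK_KInvStep Lc j) hL ρ w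

/-- [folklore] At the step resolvents: the multiplier table `M1 j` has no one-point function, for every `j` and every coarse bond. -/
theorem tadpole_KInvStep_M1_eq_zero (Lc : ℕ) [NeZero Lc] (hLc : 1 ≤ Lc) (cΛ : ℝ) (j : ℕ) (ρ : Fin (d + 1))
    (w : Fin (d + 1) → ℤ) : tadpole (KInvStep (d := d) Lc j) (M1 d Lc cΛ j ρ w) = 0 :=
  tadpole_M1_eq_zero (spr_KInvStep Lc j) (trK_KInvStep Lc j) hLc cΛ j ρ w

/-! ## §3 What parity does not kill: the one-point function of the unfolded stencil `Spure` is that of its vh border piece -/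

/-- [folklore] The one-step border piece `mfNeg (vhS d Lc κ u)` is localised. -/
theorem loc_mfNeg_vhS {Lc : ℕ} (hLc : 1 ≤ Lc) (κ : Fin (d + 1)) (u : Fin (d + 1) → ℤ) : Loc (mfNeg (vhS d Lc κ u)) :=
  ⟨u, u, _, 1, one_pos, locStencil_mfNeg (locStencil_vhS (d := d) hLc zero_le_one) κ u⟩

/-- [folklore] The value-function third jet `e3Of … j κ u` is localised (`BalabanStepJetsSucc.locStencil_e3Of`). -/
theorem loc_e3Of {Lc : ℕ} [NeZero Lc] (hLc : 1 ≤ Lc) (cE cVH cΛ : ℝ) (j : ℕ) (κ : Fin (d + 1)) (u : Fin (d + 1) → ℤ) :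
    Loc (e3Of d Lc cE cVH cΛ j κ u) := by
  obtain ⟨Cs, δ, hδ, h⟩ := locStencil_e3Of (d := d) (Lc := Lc) hLc cE cVH cΛ j
  exact ⟨u, u, Cs, δ, hδ, h κ u⟩

/-- [folklore] **MEMBER `0`: ONLY THE vh ONE-POINT FUNCTION SURVIVES.**  For any sgn-symmetric spread propagator the one-point function of
the unfolded first field stencil `Spure 0 κ u = cE • wilsonA κ u + cVH • mfNeg (vhS Lc κ u)` is `cVH · tadpole K (mfNeg (vhS Lc κ u))`:
the Wilson piece drops by parity; the border piece is OFF-diagonal, where parity is silent.  (Its value is NOT asserted.) -/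
theorem tadpole_Spure_zero {K : MKer (d + 1) (Fib d)} (hK : Spr K) (hKt : trK K = sgnK K) {Lc : ℕ} [NeZero Lc] (hLc : 1 ≤ Lc)
    (cE cVH cΛ : ℝ) (κ : Fin (d + 1)) (u : Fin (d + 1) → ℤ) :
    tadpole K (Spure d Lc cE cVH cΛ 0 κ u) = cVH * tadpole K (mfNeg (vhS d Lc κ u)) := by
  rw [Spure_zero]
  show tadpole K (cE • wilsonA d κ u + cVH • mfNeg (vhS d Lc κ u)) = cVH * tadpole K (mfNeg (vhS d Lc κ u))
  rw [tadpole_add hK ((loc_wilsonA κ u).smul cE) ((loc_mfNeg_vhS hLc κ u).smul cVH), tadpole_smul, tadpole_smul,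
    tadpole_wilsonA_eq_zero hK hKt κ u, mul_zero, zero_add]

/-- [folklore] **MEMBER `j+1`: the value-function and the vh one-point functions.**  `tadpole K (Spure (j+1) κ u) =
(cE·wE (j+1)) · tadpole K (e3Of (j+1) κ u) + (cVH·wVH (j+1)) · tadpole K (mfNeg (vhS Lc κ u))` (linearity only; no parity statement is made
for `e3Of`, whose stripped antisymmetry is not in the tree). -/
theorem tadpole_Spure_succ {K : MKer (d + 1) (Fib d)} (hK : Spr K) {Lc : ℕ} [NeZero Lc] (hLc : 1 ≤ Lc) (cE cVH cΛ : ℝ) (j : ℕ)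
    (κ : Fin (d + 1)) (u : Fin (d + 1) → ℤ) :
    tadpole K (Spure d Lc cE cVH cΛ (j + 1) κ u) =
      cE * wE d Lc (j + 1) * tadpole K (e3Of d Lc cE cVH cΛ (j + 1) κ u)
        + cVH * wVH d Lc (j + 1) * tadpole K (mfNeg (vhS d Lc κ u)) := by
  rw [Spure_succ]
  show tadpole K ((cE * wE d Lc (j + 1)) • e3Of d Lc cE cVH cΛ (j + 1) κ u + (cVH * wVH d Lc (j + 1)) • mfNeg (vhS d Lc κ u)) = _
  rw [tadpole_add hK ((loc_e3Of hLc cE cVH cΛ (j + 1) κ u).smul _) ((loc_mfNeg_vhS hLc κ u).smul _), tadpole_smul, tadpole_smul]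

/-- [folklore] **AT THE WALL'S MEMBER `0`** (`K := KInvStep Lc 0`): the one-point function of `Spure 0 κ u` is `cVH ·` the vh one —
the single finite quantity the K-R4 check reduces to at level `0`. -/
theorem tadpole_KInvStep_Spure_zero (Lc : ℕ) [NeZero Lc] (hLc : 1 ≤ Lc) (cE cVH cΛ : ℝ) (j : ℕ) (κ : Fin (d + 1))
    (u : Fin (d + 1) → ℤ) :
    tadpole (KInvStep (d := d) Lc j) (Spure d Lc cE cVH cΛ 0 κ u) =
      cVH * tadpole (KInvStep (d := d) Lc j) (mfNeg (vhS d Lc κ u)) :=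
  tadpole_Spure_zero (spr_KInvStep Lc j) (trK_KInvStep Lc j) hLc cE cVH cΛ κ u

end

end Summit.QuantumFields.BalabanUV.Beta.D1BFx.TadpoleParity
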